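import Summits.QuantumFields.YangMills.Theorems.UnitScaleTiltHistoryTailAlphaTopQuarter
import Literature.MathematicalPhysics.QuantumFieldTheory.Balaban1983to89.B5Ineq137Torus

/-!
# Route `UnitScaleTilt` — crux K2 `HistoryTail` (stmt-QuantumFields-18916): THE SMALL FACTORS OF A SEPARATED FAMILY OF TOP-LEVEL LARGE PLAQUETTES
# ADD UP IN THE MAIN TERM — `|S|·¼p(g_{K−j})² ≤ β_K·A(U_j(h,W))` for a family `S` of level-`j` plaquettes, each `θBal(K−j)`-large for the datum,
# each with its fine neighbourhood in `Ω_j(h)`, pairwise `18`-separated in the `ℓ¹` torus distance of the level-`j` lattice (support file; the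
# top-level case of the dilute-family bound `stub_diluteFamilyGlobal` of the v5′ cut / `stub_conditioning` of v5r)

Fleet lead `ym-ust-18916-p1` (gen 3), 2026-08-27.  `HistoryTailAlphaTopQuarter` (gen 2, p473459/p473712/p474213) proves (71) for ONE top-level
large plaquette deep in `Ω_j(h)` — `quarter_pFun_sq_le_localAction`: `¼p² ≤ β_K·Σ_{q∈R₀}(1 − Re tr U_j(h,W)(∂q))` with `R₀` a set of level-`0`
plaquettes based in the fine box of radius `3(L^j − 1)` around `toFine j p′.src` — and the additivity `card_mul_quarter_le_mainT` for a family
whose regions are pairwise DISJOINT.  THIS FILE supplies the missing torus geometry and knits the two: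

* §1 `toFine_eq_add_valMinAbs` — `toFine j y = toFine j y′ + L^j·(y − y′)~` coordinatewise, with `~` the least-absolute-value residue
  (`ZMod.valMinAbs`); **`pow_mul_natAbs_le_of_boxes_meet`** — if the fine boxes of radii `ρ₁`, `ρ₂` around `toFine j y`, `toFine j y′` share a fine
  site, then `L^j·|(y_ι − y′_ι)~| ≤ ρ₁ + ρ₂` in every coordinate (`N₀ = L^j·N_j`, `B5Ineq137Torus.pow_mul_sitesPerDir`, so the fine offset difference is `L^j` times a representative of
  `y_ι − y′_ι`, and the least-absolute-value residue is the smallest one: `ZMod.natAbs_min_of_le_div_two`); summed, **`pow_mul_tdist_le_of_boxes_meet`**: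
  `L^j·tdist(y, y′) ≤ d·(ρ₁ + ρ₂)`; contrapositive **`boxes_disjoint_of_tdist`**: `ρ₁ + ρ₂ < n·L^j` and `d·n ≤ tdist(y, y′)` ⇒ the boxes are disjoint.
* §2 **`card_mul_quarter_le_mainT_of_separated`** — under `MainTermIsAction`, `Constraint42Top`, `Regularity68Levels`, an admissible pair `(h, W)`,
  the two smallness conditions on `θBal(K−j)` of `quarter_pFun_sq_le_localAction` (both hold below the threshold `exists_gamma_quarter_regime`), for
  every finite family `S ⊂ Plaq_j` with (a) `toFine j q.src + [−8L^j, 8L^j]³ ⊆ Ω_j(h)`, (b) `θBal(K−j) ≤ |W(∂q) − 1|` for `q ∈ S`, and (c) `18 ≤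
  tdist(q.src, q′.src)` for `q ≠ q′` in `S` (radii `3(L^j−1) + 3(L^j−1) < 6·L^j`, `d = 3`): `|S|·¼p(g_{K−j})² ≤ mainT_j^{(K)}(h, W)`.
  [Balaban1985UV3] p.273 «We get these small factors for all plaquettes in all large fields set P» — for the datum's own large plaquettes of a
  separated family, as ONE deduction from the interface clauses; the separation `18` (level-`j` units) is dominated by any collar-sized separation
  `ccol·x(g)^{r₀}`, `ccol ≥ 18`, of the dilute-family stub.

References: T. Bałaban, CMP 102 (1985) 255–275 [Balaban1985UV3] ((41) p.266, (67)–(71) p.273); CMP 109 (1987) 249–301 [Balaban1987RG1] ((0.1) p.251).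
-/

noncomputable section

open scoped BigOperators

namespace Summit.QuantumFields.YangMills.Theorems.HistoryTailAlphaTopFamily

open Literature.MathematicalPhysics.QuantumFieldTheory.Balaban1983to89
open T4Continuum BlockAveraging
open T3ContinuumYM3Torus T3UnitScaleTilt T3UnitLawDensityEML
open T3AlphaInputsAC
open B10Eq38TorusDomains (toFine)
open B5Ineq137Torus (pow_mul_sitesPerDir)
open Summit.QuantumFields.YangMills.Theorems.HistoryTailBlockFootprint (toFine_add_intVec)
open Summit.QuantumFields.YangMills.Theorems.HistoryTailAlphaTopQuarter (quarter_pFun_sq_le_localAction card_mul_quarter_le_mainT)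

/-! ## §1 Torus geometry: the scale-`j` distance of two sites whose fine boxes meet -/

section Geometry

variable {P : Params}

/-- **`toFine j y = toFine j y′ + L^j·(y − y′)~`** with the least-absolute-value residues `(y_ι − y′_ι)~ ∈ ℤ` of the coordinate differences.
[cite: Balaban1987RG1, (0.1) p.251] -/
theorem toFine_eq_add_valMinAbs (j : ℕ) (y y' : Site P j) :
    toFine j y = toFine j y' +
      (show Site P 0 from fun ι => ((((P.L : ℤ) ^ j * (y ι - y' ι).valMinAbs : ℤ)) : ZMod (P.sitesPerDir 0))) := by
  have hy : y = y' + (show Site P j from fun ι => (((y ι - y' ι).valMinAbs : ℤ) : ZMod (P.sitesPerDir j))) := by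
    funext ι
    show y ι = y' ι + (((y ι - y' ι).valMinAbs : ℤ) : ZMod (P.sitesPerDir j))
    rw [ZMod.coe_valMinAbs]; ring
  conv_lhs => rw [hy]
  exact toFine_add_intVec j y' _

/-- **IF TWO FINE BOXES MEET, THEIR CENTRES ARE CLOSE AT SCALE `j`, COORDINATEWISE**: if a fine site `r` lies in the box of radius `ρ₁` around
`toFine j y` and in the box of radius `ρ₂` around `toFine j y′` (coordinatewise integer offsets), then `L^j·|(y_ι − y′_ι)~| ≤ ρ₁ + ρ₂` for every
coordinate `ι` — the fine offset difference is `L^j` times SOME representative of `y_ι − y′_ι` modulo `N_j` (because `N_0 = L^j·N_j`), and the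
least-absolute-value residue is the smallest representative. [cite: Balaban1987RG1, (0.1) p.251] -/
theorem pow_mul_natAbs_le_of_boxes_meet {j : ℕ} (hj : j ≤ P.m + P.K) {y y' : Site P j} {r : Site P 0} {ρ₁ ρ₂ : ℤ}
    (h₁ : ∀ ι, ∃ e : ℤ, |e| ≤ ρ₁ ∧ r ι = toFine j y ι + (e : ZMod (P.sitesPerDir 0)))
    (h₂ : ∀ ι, ∃ e : ℤ, |e| ≤ ρ₂ ∧ r ι = toFine j y' ι + (e : ZMod (P.sitesPerDir 0))) (ι : Fin P.d) :
    (P.L : ℤ) ^ j * (((y ι - y' ι).valMinAbs.natAbs : ℕ) : ℤ) ≤ ρ₁ + ρ₂ := by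
  obtain ⟨e₁, he₁, hr₁⟩ := h₁ ι
  obtain ⟨e₂, he₂, hr₂⟩ := h₂ ι
  set f : ℤ := (y ι - y' ι).valMinAbs with hf
  -- `toFine j y ι = toFine j y' ι + L^j f`
  have hcoord : toFine j y ι = toFine j y' ι + ((((P.L : ℤ) ^ j * f : ℤ)) : ZMod (P.sitesPerDir 0)) :=
    congrFun (toFine_eq_add_valMinAbs j y y') ι
  -- hence `L^j f ≡ e₂ − e₁ (mod N₀)`
  have hcast : ((((P.L : ℤ) ^ j * f : ℤ)) : ZMod (P.sitesPerDir 0)) = (((e₂ - e₁ : ℤ)) : ZMod (P.sitesPerDir 0)) := by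
    have h := hr₁.symm.trans hr₂
    rw [hcoord] at h
    push_cast at h ⊢
    linear_combination h
  rw [ZMod.intCast_eq_intCast_iff_dvd_sub] at hcast
  obtain ⟨t, ht⟩ := hcast
  have hN : ((P.sitesPerDir 0 : ℕ) : ℤ) = (P.L : ℤ) ^ j * (P.sitesPerDir j : ℤ) := by
    rw [← pow_mul_sitesPerDir P hj]; push_cast; ring
  -- `e₂ − e₁ = L^j·(f + N_j t)`
  have hg : e₂ - e₁ = (P.L : ℤ) ^ j * (f + (P.sitesPerDir j : ℤ) * t) := by
    rw [hN] at ht; linear_combination ht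
  -- minimality of the least-absolute-value residue
  have hmin : f.natAbs ≤ (f + (P.sitesPerDir j : ℤ) * t).natAbs := by
    apply ZMod.natAbs_min_of_le_div_two (P.sitesPerDir j)
    · push_cast
      rw [ZMod.natCast_self, zero_mul, add_zero]
    · exact ZMod.natAbs_valMinAbs_le _
  have hL0 : (0 : ℤ) ≤ (P.L : ℤ) ^ j := by positivity
  calc (P.L : ℤ) ^ j * ((f.natAbs : ℕ) : ℤ)
      ≤ (P.L : ℤ) ^ j * (((f + (P.sitesPerDir j : ℤ) * t).natAbs : ℕ) : ℤ) :=
        mul_le_mul_of_nonneg_left (by exact_mod_cast hmin) hL0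
    _ = |e₂ - e₁| := by rw [Int.natCast_natAbs, hg, abs_mul, abs_of_nonneg hL0]
    _ ≤ |e₂| + |e₁| := abs_sub _ _
    _ ≤ ρ₁ + ρ₂ := by linarith

/-- kernel: the least-absolute-value residue measures the cyclic distance of one coordinate. [folklore] -/
private theorem natAbs_valMinAbs_eq_min {n : ℕ} [NeZero n] (a : ZMod n) : a.valMinAbs.natAbs = min a.val (-a).val := by
  rw [ZMod.valMinAbs_natAbs_eq_min, ZMod.neg_val]
  split_ifs with h
  · subst h; simp
  · rfl

/-- The `ℓ¹` torus distance as the sum of the least-absolute-value residues of the coordinate differences (same statement as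
`B3Taylor310LocalRemainder.tdist_eq_sum_natAbs`, re-derived to keep this file's imports on the route's cone). [folklore] -/
theorem tdist_eq_sum_natAbs_valMinAbs {j : ℕ} (x y : Site P j) :
    Site.tdist x y = ∑ μ : Fin P.d, ((x μ - y μ).valMinAbs).natAbs := by
  unfold Site.tdist
  exact Finset.sum_congr rfl fun μ _ => by rw [natAbs_valMinAbs_eq_min, neg_sub]

/-- **IF TWO FINE BOXES MEET, THEIR CENTRES ARE CLOSE AT SCALE `j`**: `L^j·tdist(y, y′) ≤ d·(ρ₁ + ρ₂)` (sum of
`pow_mul_natAbs_le_of_boxes_meet` over the coordinates). [cite: Balaban1987RG1, (0.1) p.251] -/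
theorem pow_mul_tdist_le_of_boxes_meet {j : ℕ} (hj : j ≤ P.m + P.K) {y y' : Site P j} {r : Site P 0} {ρ₁ ρ₂ : ℤ}
    (h₁ : ∀ ι, ∃ e : ℤ, |e| ≤ ρ₁ ∧ r ι = toFine j y ι + (e : ZMod (P.sitesPerDir 0)))
    (h₂ : ∀ ι, ∃ e : ℤ, |e| ≤ ρ₂ ∧ r ι = toFine j y' ι + (e : ZMod (P.sitesPerDir 0))) :
    (P.L : ℤ) ^ j * (Site.tdist y y' : ℤ) ≤ (P.d : ℤ) * (ρ₁ + ρ₂) := by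
  rw [tdist_eq_sum_natAbs_valMinAbs, Nat.cast_sum, Finset.mul_sum]
  calc ∑ ι : Fin P.d, (P.L : ℤ) ^ j * (((y ι - y' ι).valMinAbs.natAbs : ℕ) : ℤ)
      ≤ ∑ _ι : Fin P.d, (ρ₁ + ρ₂) := Finset.sum_le_sum fun ι _ => pow_mul_natAbs_le_of_boxes_meet hj h₁ h₂ ι
    _ = (P.d : ℤ) * (ρ₁ + ρ₂) := by simp

/-- **SEPARATED CENTRES HAVE DISJOINT FINE BOXES**: if `ρ₁ + ρ₂ < n·L^j` and `d·n ≤ tdist(y, y′)`, the fine boxes of radii `ρ₁`, `ρ₂` around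
`toFine j y`, `toFine j y′` are disjoint. [cite: Balaban1987RG1, (0.1) p.251] -/
theorem boxes_disjoint_of_tdist {j : ℕ} (hj : j ≤ P.m + P.K) {y y' : Site P j} {ρ₁ ρ₂ : ℤ} {n : ℕ}
    (hρ : ρ₁ + ρ₂ < (n : ℤ) * (P.L : ℤ) ^ j) (hsep : P.d * n ≤ Site.tdist y y') :
    Disjoint {r : Site P 0 | ∀ ι, ∃ e : ℤ, |e| ≤ ρ₁ ∧ r ι = toFine j y ι + (e : ZMod (P.sitesPerDir 0))}
      {r : Site P 0 | ∀ ι, ∃ e : ℤ, |e| ≤ ρ₂ ∧ r ι = toFine j y' ι + (e : ZMod (P.sitesPerDir 0))} := by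
  rw [Set.disjoint_left]
  intro r h₁ h₂
  have h := pow_mul_tdist_le_of_boxes_meet hj h₁ h₂
  have hsep' : (P.d : ℤ) * (n : ℤ) ≤ (Site.tdist y y' : ℤ) := by exact_mod_cast hsep
  have hL0 : (0 : ℤ) ≤ (P.L : ℤ) ^ j := by positivity
  have hd1 : (1 : ℤ) ≤ (P.d : ℤ) := by exact_mod_cast P.hd
  -- `L^j·d·n ≤ L^j·tdist ≤ d(ρ₁+ρ₂) < d·n·L^j`
  have h1 : (P.L : ℤ) ^ j * ((P.d : ℤ) * (n : ℤ)) ≤ (P.d : ℤ) * (ρ₁ + ρ₂) :=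
    (mul_le_mul_of_nonneg_left hsep' hL0).trans h
  have h2 : (P.d : ℤ) * (ρ₁ + ρ₂) < (P.d : ℤ) * ((n : ℤ) * (P.L : ℤ) ^ j) :=
    mul_lt_mul_of_pos_left hρ (by linarith)
  nlinarith

end Geometry

/-! ## §2 The small factors of a separated family of top-level large plaquettes add up in the main term -/

variable {F : T3Family} {γ : ℝ} {D : AlphaDataT3 F γ}

/-- **THE SMALL FACTORS OF A SEPARATED FAMILY OF TOP-LEVEL LARGE PLAQUETTES DEEP IN `Ω_j(h)` ADD UP IN THE MAIN TERM** (`SU(2)`, `d = 3`): under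
`MainTermIsAction`, `Constraint42Top`, `Regularity68Levels`, an admissible pair `(h, W)` and the two smallness conditions on `θBal(K−j)`, for a finite
family `S` of level-`j` plaquettes with their fine neighbourhoods `toFine j q.src + [−8L^j, 8L^j]³` in `Ω_j(h)`, each `θBal(K−j)`-large for `W`, and
pairwise `18`-separated base sites (`ℓ¹` torus distance of `T^{(j)}`): `|S|·¼·p(g_{K−j})² ≤ mainT_j^{(K)}(h, W)` — (71) for every member
(`quarter_pFun_sq_le_localAction`), the regions pairwise disjoint (`boxes_disjoint_of_tdist` with radii `3(L^j − 1)`), additivity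
(`card_mul_quarter_le_mainT`). [cite: Balaban1985UV3, (41) p.266 and (71) p.273] -/
theorem card_mul_quarter_le_mainT_of_separated (hγ : 0 < γ) (hγ1 : γ ≤ 1) {b₀ : ℝ} (hb₀ : 0 ≤ b₀) (p₀ : ℝ) {C68 : ℝ} (hC68 : 0 ≤ C68)
    (hM : MainTermIsAction D) (h42 : Constraint42Top D) (h68 : Regularity68Levels D b₀ p₀ C68)
    {K j : ℕ} (hjK : j ≤ K) (h : D.Hist K j) (W : GaugeField (F.P K) j (Matrix.specialUnitaryGroup (Fin 2) ℂ)) (hadm : D.Adm K j h W)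
    (hθ1 : ((((3 + 2) * F.L : ℕ) : ℝ) ^ 2 / 4) * (C68 * θBal F.L γ b₀ p₀ (K - j)) ≤ 1 / 10)
    (hθ2 : 540 * (435 ^ 2 * (C68 * (((3 + 2) * F.L : ℕ) : ℝ) ^ 2 / 4) ^ 4) * θBal F.L γ b₀ p₀ (K - j) ^ 2 ≤ 1 / 4)
    (S : Finset (Plaq (F.P K) j))
    (hΩ : ∀ q ∈ S, {x : Site (F.P K) 0 | ∀ ι, ∃ e : ℤ, |e| ≤ 8 * ((F.P K).L : ℤ) ^ j ∧
      x ι = toFine j q.src ι + (e : ZMod ((F.P K).sitesPerDir 0))} ⊆ D.Ω K j h j)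
    (hlarge : ∀ q ∈ S, θBal F.L γ b₀ p₀ (K - j) ≤ GaugeGroup.dist1 (GaugeField.plaqHol W q))
    (hsep : ∀ q ∈ S, ∀ q' ∈ S, q ≠ q' → 18 ≤ Site.tdist q.src q'.src) :
    (S.card : ℝ) * ((1 / 4 : ℝ) * B10.pFun b₀ p₀ (Real.sqrt (γ * ((F.L : ℝ)⁻¹) ^ (K - j))) ^ 2) ≤ D.mainT K j h W := by
  classical
  -- the regions under the members
  have hreg : ∀ q ∈ S, ∃ R₀ : Finset (Plaq (F.P K) 0),
      (∀ r ∈ R₀, ∀ ι, ∃ e : ℤ, |e| ≤ 3 * (((F.P K).L : ℤ) ^ j - 1) ∧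
        r.src ι = toFine j q.src ι + (e : ZMod ((F.P K).sitesPerDir 0))) ∧
      (1 / 4 : ℝ) * B10.pFun b₀ p₀ (Real.sqrt (γ * ((F.L : ℝ)⁻¹) ^ (K - j))) ^ 2 ≤
        (F.scheme ℰp γ).β K * ∑ r ∈ R₀, (1 - reTr (GaugeField.plaqHol (D.Umin K j h W) r)) := fun q hq =>
    quarter_pFun_sq_le_localAction hγ hγ1 hb₀ p₀ hC68 h42 h68 hjK h W hadm q (hΩ q hq) (hlarge q hq) hθ1 hθ2
  choose! R₀ hfoot hbound using hreg
  refine card_mul_quarter_le_mainT hM hγ.le h W S R₀ ?_ _ hbound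
  -- the regions are pairwise disjoint
  intro q hq q' hq' hne
  rw [Function.onFun, Finset.disjoint_left]
  intro r hr hr'
  have hj : j ≤ (F.P K).m + (F.P K).K := by
    show j ≤ F.m + K
    omega
  have hd : (F.P K).d = 3 := rfl
  have hL1 : (1 : ℤ) ≤ ((F.P K).L : ℤ) := by exact_mod_cast (F.P K).hL.2.le
  have hLj : (1 : ℤ) ≤ ((F.P K).L : ℤ) ^ j := one_le_pow₀ hL1
  have hdis := boxes_disjoint_of_tdist hj (y := q.src) (y' := q'.src)
    (ρ₁ := 3 * (((F.P K).L : ℤ) ^ j - 1)) (ρ₂ := 3 * (((F.P K).L : ℤ) ^ j - 1)) (n := 6)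
    (by push_cast; linarith) (by rw [hd]; exact hsep q (Finset.mem_coe.mp hq) q' (Finset.mem_coe.mp hq') hne)
  exact Set.disjoint_left.mp hdis (hfoot q (Finset.mem_coe.mp hq) r hr) (hfoot q' (Finset.mem_coe.mp hq') r hr')

end Summit.QuantumFields.YangMills.Theorems.HistoryTailAlphaTopFamily

end
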